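import Mathlib
import Literature.Analysis.FluidPDE.VectorCalculus
import Literature.Analysis.FluidPDE.SelfSimilarEulerProfile
import Literature.Analysis.FluidPDE.SelfSimilarEulerProfileVorticity
import HarnessLib

/-!
# THE RAY LAW: along a forward self-similar trajectory with integrable strain the renormalised vorticity `e^{s}Ω(X(s))` has a NON-ZERO limit
# (nsreg-p2 SEEDS-R54 S3, plate t58-ODE «any hand, pure Mathlib»: `NsregP2.R54.Seeds.LinearODELimitLaw` and `RayVorticityLaw ρ V` VERBATIM, r54/Seed54.lean 7981cb898dc3f79a;
# seat ns-ezl-w3 g8, `--supports stmt-NavierStokesRegularity-19832 --as helper`)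

* `RayVorticity.norm_bounds_of_linearODE` — for `z′ = A(s)z` on `[0,∞)` (`A` continuous there): `‖z 0‖e^{−a(t)} ≤ ‖z t‖ ≤ ‖z 0‖e^{a(t)}`, `a(t) = ∫₀ᵗ‖A‖`
  (forward/backward Grönwall as MONOTONICITY of `e^{∓2a(t)}‖z(t)‖²`, whose derivatives are `2e^{∓2a}(±(⟪z, Az⟫) − … ) ≤ 0`, resp. `≥ 0`);
* `RayVorticity.tendsto_of_linearODE_of_integrable` — if moreover `∫_{[0,∞)}‖A‖ < ∞` then `z(t) → z_∞ = z(0) + ∫_{(0,∞)} A(s)z(s) ds` and `z(0) ≠ 0 ⇒ z_∞ ≠ 0`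
  (`‖A(s)z(s)‖ ≤ ‖z 0‖e^{I}‖A s‖ ∈ L¹`, FTC + `intervalIntegral_tendsto_integral_Ioi`; `‖z_∞‖ ≥ ‖z 0‖e^{−I}`) — any real inner-product space;
* ★ `RayVorticity.linearODELimitLaw` = `NsregP2.R54.Seeds.LinearODELimitLaw` VERBATIM (`E3 = EuclideanSpace ℝ (Fin 3)` spelled out);
* ★ `RayVorticity.rayVorticityLaw (ρ V)` = `NsregP2.R54.Seeds.RayVorticityLaw ρ V` VERBATIM, by the seed's reduction (chain rule + the vorticity equation
  `Ω + DΩ[γy + V] = DV·Ω`, Literature `IsSelfSimilarEulerVorticityProfile.vorticity_eq`; the seed file is not in the tree, so the reduction is re-proved here).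

HONEST FRAMING: Cauchy's vorticity formula along self-similar Lagrangian trajectories, i.e. a PORTRAIT instrument about HYPOTHETICAL profiles (known mechanism; SEEDS-R54 S3 (c3));
nothing about the crux E (`PowerGaugeEulerLiouville`, stmt 19832, OPEN) or NS regularity is proved; MODEL-lattice crux class; not E. [folklore (Grönwall); ConstantinIgnatovaVicol2026Putative §3.1.1 (3.4)]
-/

noncomputable section

set_option linter.dupNamespace false

open MeasureTheory Set Filter Topology Metric Function
open scoped Topology RealInnerProductSpace

namespace Summit.NavierStokesRegularity.NavierStokesRegularity.Theorems.PowerGaugeEulerLiouville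

open Literature.Analysis Literature.Analysis.FluidPDE

namespace RayVorticity

section Abstract

variable {E : Type*} [NormedAddCommGroup E] [InnerProductSpace ℝ E] [CompleteSpace E]

omit [CompleteSpace E] in
/-- **Two-sided exponential bounds for `z′ = A(s)z`** (`A` continuous on `[0,∞)`, `t ≥ 0`):
`‖z 0‖·exp(−∫₀ᵗ‖A‖) ≤ ‖z t‖ ≤ ‖z 0‖·exp(∫₀ᵗ‖A‖)` — monotonicity of `exp(∓2∫₀ᵗ‖A‖)·‖z t‖²` on `[0,∞)` (`|⟪z, Az⟫| ≤ ‖A‖‖z‖²`). [folklore (Grönwall)] -/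
theorem norm_bounds_of_linearODE {A : ℝ → (E →L[ℝ] E)} {z : ℝ → E}
    (hA : ContinuousOn A (Ici 0)) (hz : ∀ s : ℝ, 0 ≤ s → HasDerivAt z (A s (z s)) s) {t : ℝ} (ht : 0 ≤ t) :
    ‖z 0‖ * Real.exp (-(∫ s in (0 : ℝ)..t, ‖A s‖)) ≤ ‖z t‖ ∧
      ‖z t‖ ≤ ‖z 0‖ * Real.exp (∫ s in (0 : ℝ)..t, ‖A s‖) := by
  -- a continuous extension of `A` to `ℝ` and its integrated norm
  set B : ℝ → (E →L[ℝ] E) := fun s => A (max s 0) with hBdef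
  have hB : Continuous B := hA.comp_continuous (continuous_id.max continuous_const) fun s => mem_Ici.2 (le_max_right s 0)
  have hnB : Continuous fun s => ‖B s‖ := hB.norm
  have hBA : ∀ s, 0 ≤ s → B s = A s := fun s hs => by simp only [hBdef, max_eq_left hs]
  set a : ℝ → ℝ := fun t => ∫ s in (0 : ℝ)..t, ‖B s‖ with hadef
  have ha : ∀ t, HasDerivAt a (‖B t‖) t := fun t =>
    intervalIntegral.integral_hasDerivAt_right (hnB.intervalIntegrable _ _) (hnB.stronglyMeasurableAtFilter _ _) hnB.continuousAt
  have ha0 : a 0 = 0 := by simp [hadef]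
  have haA : a t = ∫ s in (0 : ℝ)..t, ‖A s‖ := by
    refine intervalIntegral.integral_congr fun s hs => ?_
    rw [uIcc_of_le ht] at hs
    simp only [hBA s hs.1]
  -- the derivative of `‖z‖²` on `[0, ∞)`
  have hz' : ∀ s, 0 ≤ s → HasDerivAt z (B s (z s)) s := fun s hs => by rw [hBA s hs]; exact hz s hs
  have hN : ∀ s, 0 ≤ s → HasDerivAt (fun u => ‖z u‖ ^ 2) (2 * ⟪z s, B s (z s)⟫) s := fun s hs => (hz' s hs).norm_sq
  have hinner : ∀ s, |⟪z s, B s (z s)⟫| ≤ ‖B s‖ * ‖z s‖ ^ 2 := fun s => by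
    calc |⟪z s, B s (z s)⟫| ≤ ‖z s‖ * ‖B s (z s)‖ := abs_real_inner_le_norm _ _
      _ ≤ ‖z s‖ * (‖B s‖ * ‖z s‖) := mul_le_mul_of_nonneg_left ((B s).le_opNorm _) (norm_nonneg _)
      _ = ‖B s‖ * ‖z s‖ ^ 2 := by ring
  -- `φ₊ = e^{−2a}‖z‖²` is antitone, `φ₋ = e^{2a}‖z‖²` is monotone on `[0, ∞)`
  set φp : ℝ → ℝ := fun u => Real.exp (-2 * a u) * ‖z u‖ ^ 2 with hφpdef
  set φm : ℝ → ℝ := fun u => Real.exp (2 * a u) * ‖z u‖ ^ 2 with hφmdef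
  have hφp : ∀ s, 0 ≤ s → HasDerivAt φp
      (Real.exp (-2 * a s) * (-2 * ‖B s‖) * ‖z s‖ ^ 2 + Real.exp (-2 * a s) * (2 * ⟪z s, B s (z s)⟫)) s := by
    intro s hs
    have h1 : HasDerivAt (fun u => Real.exp (-2 * a u)) (Real.exp (-2 * a s) * (-2 * ‖B s‖)) s :=
      ((ha s).const_mul (-2)).exp
    exact h1.mul (hN s hs)
  have hφm : ∀ s, 0 ≤ s → HasDerivAt φm
      (Real.exp (2 * a s) * (2 * ‖B s‖) * ‖z s‖ ^ 2 + Real.exp (2 * a s) * (2 * ⟪z s, B s (z s)⟫)) s := by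
    intro s hs
    have h1 : HasDerivAt (fun u => Real.exp (2 * a u)) (Real.exp (2 * a s) * (2 * ‖B s‖)) s :=
      ((ha s).const_mul 2).exp
    exact h1.mul (hN s hs)
  have hanti : AntitoneOn φp (Ici 0) := by
    refine antitoneOn_of_deriv_nonpos (convex_Ici 0) (fun s hs => (hφp s hs).continuousAt.continuousWithinAt)
      (fun s hs => ?_) (fun s hs => ?_)
    · rw [interior_Ici] at hs
      exact (hφp s (le_of_lt hs)).differentiableAt.differentiableWithinAt
    · rw [interior_Ici] at hs
      rw [(hφp s (le_of_lt hs)).deriv]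
      have he : 0 < Real.exp (-2 * a s) := Real.exp_pos _
      have hi := (abs_le.1 (hinner s)).2
      nlinarith [mul_le_mul_of_nonneg_left hi he.le, sq_nonneg ‖z s‖]
  have hmono : MonotoneOn φm (Ici 0) := by
    refine monotoneOn_of_deriv_nonneg (convex_Ici 0) (fun s hs => (hφm s hs).continuousAt.continuousWithinAt)
      (fun s hs => ?_) (fun s hs => ?_)
    · rw [interior_Ici] at hs
      exact (hφm s (le_of_lt hs)).differentiableAt.differentiableWithinAt
    · rw [interior_Ici] at hs
      rw [(hφm s (le_of_lt hs)).deriv]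
      have he : 0 < Real.exp (2 * a s) := Real.exp_pos _
      have hi := (abs_le.1 (hinner s)).1
      nlinarith [mul_le_mul_of_nonneg_left hi he.le, sq_nonneg ‖z s‖]
  have hp := hanti (self_mem_Ici : (0 : ℝ) ∈ Ici 0) ht ht   -- φp t ≤ φp 0
  have hm := hmono (self_mem_Ici : (0 : ℝ) ∈ Ici 0) ht ht   -- φm 0 ≤ φm t
  simp only [hφpdef, hφmdef, ha0, mul_zero, Real.exp_zero, one_mul] at hp hm
  -- unwrap the squares
  have hz0 : 0 ≤ ‖z 0‖ := norm_nonneg _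
  have hzt : 0 ≤ ‖z t‖ := norm_nonneg _
  have hE1 : Real.exp (-a t) ^ 2 * Real.exp (2 * a t) = 1 := by
    rw [sq, ← Real.exp_add, ← Real.exp_add, show -a t + -a t + 2 * a t = 0 by ring, Real.exp_zero]
  have hE2 : Real.exp (a t) ^ 2 * Real.exp (-2 * a t) = 1 := by
    rw [sq, ← Real.exp_add, ← Real.exp_add, show a t + a t + -2 * a t = 0 by ring, Real.exp_zero]
  rw [← haA]
  constructor
  · refine le_of_sq_le_sq ?_ hzt
    calc (‖z 0‖ * Real.exp (-a t)) ^ 2 = ‖z 0‖ ^ 2 * Real.exp (-a t) ^ 2 := by ring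
      _ ≤ (Real.exp (2 * a t) * ‖z t‖ ^ 2) * Real.exp (-a t) ^ 2 := mul_le_mul_of_nonneg_right hm (sq_nonneg _)
      _ = ‖z t‖ ^ 2 * (Real.exp (-a t) ^ 2 * Real.exp (2 * a t)) := by ring
      _ = ‖z t‖ ^ 2 := by rw [hE1, mul_one]
  · refine le_of_sq_le_sq ?_ (by positivity)
    calc ‖z t‖ ^ 2 = ‖z t‖ ^ 2 * (Real.exp (a t) ^ 2 * Real.exp (-2 * a t)) := by rw [hE2, mul_one]
      _ = (Real.exp (-2 * a t) * ‖z t‖ ^ 2) * Real.exp (a t) ^ 2 := by ring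
      _ ≤ ‖z 0‖ ^ 2 * Real.exp (a t) ^ 2 := mul_le_mul_of_nonneg_right hp (sq_nonneg _)
      _ = (‖z 0‖ * Real.exp (a t)) ^ 2 := by ring

/-- **Limit of `z′ = A(s)z` under an integrable coefficient** (any complete real inner-product space): if `A` is continuous on `[0,∞)` with
`∫_{[0,∞)}‖A‖ < ∞` and `z′(s) = A(s)z(s)` for `s ≥ 0`, then `z(t) → z_∞` as `t → ∞` and `z(0) ≠ 0 ⇒ z_∞ ≠ 0`
(`z_∞ = z(0) + ∫_{(0,∞)} A(s)z(s) ds`, the integrand being dominated by `‖z 0‖e^{I}·‖A s‖`; `‖z_∞‖ ≥ ‖z 0‖e^{−I}`). [folklore (Grönwall)] -/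
theorem tendsto_of_linearODE_of_integrable {A : ℝ → (E →L[ℝ] E)} {z : ℝ → E}
    (hA : ContinuousOn A (Ici 0)) (hz : ∀ s : ℝ, 0 ≤ s → HasDerivAt z (A s (z s)) s)
    (hint : IntegrableOn (fun s => ‖A s‖) (Ici 0)) :
    ∃ zinf : E, Tendsto z atTop (𝓝 zinf) ∧ (z 0 ≠ 0 → zinf ≠ 0) := by
  set I : ℝ := ∫ s in Ici (0 : ℝ), ‖A s‖ with hIdef
  have hI0 : 0 ≤ I := setIntegral_nonneg measurableSet_Ici fun s _ => norm_nonneg _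
  -- `∫₀ᵗ ‖A‖ ≤ I` for `t ≥ 0`
  have haI : ∀ t : ℝ, 0 ≤ t → ∫ s in (0 : ℝ)..t, ‖A s‖ ≤ I := by
    intro t ht
    rw [intervalIntegral.integral_of_le ht]
    exact setIntegral_mono_set hint (ae_of_all _ fun s => norm_nonneg _) (ae_of_all _ fun x hx => mem_Ici.2 (le_of_lt hx.1))
  -- the uniform bounds `‖z 0‖e^{−I} ≤ ‖z t‖ ≤ M = ‖z 0‖e^{I}` on `[0, ∞)`
  set M : ℝ := ‖z 0‖ * Real.exp I with hMdef
  have hM0 : 0 ≤ M := by positivity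
  have hzM : ∀ t : ℝ, 0 ≤ t → ‖z t‖ ≤ M := fun t ht =>
    (norm_bounds_of_linearODE hA hz ht).2.trans
      (mul_le_mul_of_nonneg_left (Real.exp_le_exp.2 (haI t ht)) (norm_nonneg _))
  have hzm : ∀ t : ℝ, 0 ≤ t → ‖z 0‖ * Real.exp (-I) ≤ ‖z t‖ := fun t ht =>
    (mul_le_mul_of_nonneg_left (Real.exp_le_exp.2 (neg_le_neg (haI t ht))) (norm_nonneg _)).trans
      (norm_bounds_of_linearODE hA hz ht).1
  -- the derivative `g = A z` is integrable on `(0, ∞)`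
  set g : ℝ → E := fun s => A s (z s) with hgdef
  have hzc : ContinuousOn z (Ici 0) := fun s hs => (hz s hs).continuousAt.continuousWithinAt
  have hgc : ContinuousOn g (Ici 0) := hA.clm_apply hzc
  have hgint : IntegrableOn g (Ioi 0) := by
    refine Integrable.mono' ((hint.mono_set Ioi_subset_Ici_self).const_mul M)
      ((hgc.mono Ioi_subset_Ici_self).aestronglyMeasurable measurableSet_Ioi)
      ((ae_restrict_iff' measurableSet_Ioi).2 (ae_of_all _ fun s hs => ?_))
    calc ‖g s‖ ≤ ‖A s‖ * ‖z s‖ := (A s).le_opNorm _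
      _ ≤ ‖A s‖ * M := mul_le_mul_of_nonneg_left (hzM s (le_of_lt hs)) (norm_nonneg _)
      _ = M * ‖A s‖ := mul_comm _ _
  -- FTC on `[0, T]` and the limit of `∫₀ᵀ g`
  have hFTC : ∀ T : ℝ, 0 ≤ T → ∫ s in (0 : ℝ)..T, g s = z T - z 0 := by
    intro T hT
    refine intervalIntegral.integral_eq_sub_of_hasDerivAt (fun s hs => ?_)
      ((intervalIntegrable_iff_integrableOn_Ioc_of_le hT).2 (hgint.mono_set Ioc_subset_Ioi_self))
    rw [uIcc_of_le hT] at hs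
    exact hz s hs.1
  have hlim := intervalIntegral_tendsto_integral_Ioi 0 hgint tendsto_id
  set zinf : E := z 0 + ∫ s in Ioi (0 : ℝ), g s with hzinf
  have hz_tendsto : Tendsto z atTop (𝓝 zinf) := by
    have h : Tendsto (fun T : ℝ => z 0 + ∫ s in (0 : ℝ)..T, g s) atTop (𝓝 zinf) := tendsto_const_nhds.add hlim
    refine h.congr' ?_
    filter_upwards [eventually_ge_atTop (0 : ℝ)] with T hT
    rw [hFTC T hT]; abel
  refine ⟨zinf, hz_tendsto, fun h0 hzero => ?_⟩
  -- `‖z_∞‖ ≥ ‖z 0‖e^{−I} > 0`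
  have hpos : 0 < ‖z 0‖ * Real.exp (-I) := mul_pos (norm_pos_iff.2 h0) (Real.exp_pos _)
  have hge : ‖z 0‖ * Real.exp (-I) ≤ ‖zinf‖ :=
    ge_of_tendsto (hz_tendsto.norm) (Filter.eventually_atTop.2 ⟨0, fun t ht => hzm t ht⟩)
  rw [hzero, norm_zero] at hge
  linarith

end Abstract

/-! ## The typed seeds of SEEDS-R54 S3, verbatim -/

/-- ★ **`NsregP2.R54.Seeds.LinearODELimitLaw` VERBATIM** (plate t58-ODE): a solution of `z′ = A(s)z` on `[0,∞)` with a continuous coefficient of integrable norm has a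
limit at `∞`, non-zero if `z(0) ≠ 0`. [folklore (Grönwall)] -/
theorem linearODELimitLaw :
    ∀ (A : ℝ → (EuclideanSpace ℝ (Fin 3) →L[ℝ] EuclideanSpace ℝ (Fin 3))) (z : ℝ → EuclideanSpace ℝ (Fin 3)),
      ContinuousOn A (Ici 0) →
      (∀ s : ℝ, 0 ≤ s → HasDerivAt z (A s (z s)) s) →
      IntegrableOn (fun s => ‖A s‖) (Ici 0) →
        ∃ zinf : EuclideanSpace ℝ (Fin 3), Tendsto z atTop (𝓝 zinf) ∧ (z 0 ≠ 0 → zinf ≠ 0) :=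
  fun _ _ hA hz hint => tendsto_of_linearODE_of_integrable hA hz hint

/-- ★ **THE RAY LAW = `NsregP2.R54.Seeds.RayVorticityLaw ρ V` VERBATIM** (SEEDS-R54 S3): along every forward trajectory `X′(s) = γX(s) + V(X(s))` (`s ≥ 0`,
`γ = 1/(2+ρ)`) of a `C²` self-similar Euler profile on which the strain is integrable, `∫₀^∞‖DV(X(s))‖ds < ∞`, the renormalised vorticity `e^{s}·curl V(X(s))`
converges, to a NON-ZERO vector if `curl V(X(0)) ≠ 0`. Reduction (the seed's, re-proved): `z(s) = e^{s}Ω(X(s))` solves `z′ = DV(X(s))·z` by the chain rule and the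
vorticity equation `Ω + DΩ[γy + V] = DV·Ω` (Literature `IsSelfSimilarEulerVorticityProfile.vorticity_eq`); then `linearODELimitLaw`.
[nsreg-p2 SEEDS-R54 S3; cite: ConstantinIgnatovaVicol2026Putative §3.1.1 (3.4)] -/
theorem rayVorticityLaw (ρ : ℝ) (V : EuclideanSpace ℝ (Fin 3) → EuclideanSpace ℝ (Fin 3)) :
    ∀ P : EuclideanSpace ℝ (Fin 3) → ℝ, IsSelfSimilarEulerProfile (1 / (2 + ρ)) 0 V P →
      ∀ X : ℝ → EuclideanSpace ℝ (Fin 3),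
        (∀ s : ℝ, 0 ≤ s → HasDerivAt X ((1 / (2 + ρ)) • X s + V (X s)) s) →
        IntegrableOn (fun s => ‖fderiv ℝ V (X s)‖) (Ici 0) →
          ∃ ωinf : EuclideanSpace ℝ (Fin 3),
            Tendsto (fun s => Real.exp s • curl V (X s)) atTop (𝓝 ωinf) ∧ (curl V (X 0) ≠ 0 → ωinf ≠ 0) := by
  intro P hprof X hX hint
  have hvp := hprof.isSelfSimilarEulerVorticityProfile
  have hV2 : ContDiff ℝ 2 V := hvp.contDiff_velocity
  have hΩd : Differentiable ℝ (curl V) := differentiable_curl_of_contDiff hV2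
  -- the linear ODE solved by `z(s) = e^{s} Ω(X(s))`
  have key : ∀ s : ℝ, 0 ≤ s →
      HasDerivAt (fun s => Real.exp s • curl V (X s)) (fderiv ℝ V (X s) (Real.exp s • curl V (X s))) s := by
    intro s hs
    have h1 : HasDerivAt (fun s => curl V (X s))
        (fderiv ℝ (curl V) (X s) ((1 / (2 + ρ)) • X s + V (X s))) s :=
      (hΩd (X s)).hasFDerivAt.comp_hasDerivAt s (hX s hs)
    have hvort := hvp.vorticity_eq (X s)
    simp only [sub_zero] at hvort
    have h2 : fderiv ℝ (curl V) (X s) ((1 / (2 + ρ)) • X s + V (X s)) =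
        fderiv ℝ V (X s) (curl V (X s)) - curl V (X s) := by
      rw [← hvort]; abel
    rw [h2] at h1
    have h3 := (Real.hasDerivAt_exp s).smul h1
    refine h3.congr_deriv ?_
    rw [map_smul, smul_sub]
    abel
  -- continuity of the coefficient and of the trajectory on `[0, ∞)`
  have hXc : ContinuousOn X (Ici 0) := fun s hs => (hX s hs).continuousAt.continuousWithinAt
  have hAc : ContinuousOn (fun s => fderiv ℝ V (X s)) (Ici 0) :=
    (hV2.continuous_fderiv (by norm_num)).comp_continuousOn hXc
  obtain ⟨zinf, hz, hz0⟩ := linearODELimitLaw (fun s => fderiv ℝ V (X s)) (fun s => Real.exp s • curl V (X s)) hAc key hint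
  refine ⟨zinf, hz, fun hne => hz0 ?_⟩
  simpa using hne


end RayVorticity

end Summit.NavierStokesRegularity.NavierStokesRegularity.Theorems.PowerGaugeEulerLiouville

end
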